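import Mathlib
import Summits.CriticalPhenomena.PercolationContinuityZ3.Theorems.PercNearOneGluingNoHeavyLowerTailTNKernels
import HarnessLib

/-!
# Total nonnegativity of `(l + c_n)/(n-l)!` from a Hausdorff moment structure (THEOREM W♯, ⟸)

Support file for the Sahi / Conjecture-P programme of route `PercNearOneGluingNoHeavy`
(`--supports stmt-CriticalPhenomena-4575`, prover prim-l12-p5 gen 35; proof note
`prim-l12-p5/PROOF-CONJECTURE-W-g35.md` §1–3).  No definitions, no named facts, no sorries.

For a sequence `μ : ℕ → ℝ` put `σ_n := 1 - μ_n/μ_{n-1}` and let `Q_μ` be the lower triangular kernel whose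
`n`-th row (`n ≥ 1`) is the coefficient list of `(1+x)^{n-1}(x + σ_n)`:
`Q_μ(n,l) = [l ≥ 1] C(n-1,l-1) + σ_n C(n-1,l)`, `Q_μ(0,l) = [l = 0]`.

**THEOREM (`momentRatio_minor_nonneg`, `momentRatio_tn`).**  If `μ` is STRICTLY COMPLETELY MONOTONE,
`Σ_{i ≤ k} (-1)^i C(k,i) μ_{j+i} > 0` for all `j, k` (Hausdorff: `μ` is the moment sequence of a positive
measure on `[0,1]` charging `(0,1)`), then `Q_μ` is totally nonnegative.

Proof (memo §2–3): one step of Neville elimination maps the family to itself — `Q_μ = L̂ · (1 ⊕ Q_{μ'})`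
with `μ'_r = μ_r - μ_{r+1}` (again strictly completely monotone) and `L̂(n,j) = [j ≤ n] s_n/s_j`,
`s_0 = 1`, `s_n = σ_n > 0` — and the three closure lemmas of `…LowerTailTNKernels` give an induction on
the truncation size.

**COROLLARY (`lPlusC_div_factorial_tn`).**  For `c_1, c_2, … > 0` (and `c_0 > 0`): if
`μ_r := r!/∏_{m=1}^{r}(m + c_m)` is strictly completely monotone then the kernel
`(n,l) ↦ (l + c_n)/(n-l)!` (`l ≤ n`) is totally nonnegative — g34's CONJECTURE W in its exact form
(the Stieltjes/Beta-product instances are in `…LowerTailMomentRatioTNBeta`).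
-/

namespace Summit.CriticalPhenomena.PercolationContinuityZ3.Theorems

namespace MomentRatioTN

open Finset Matrix
open scoped Nat

/-! ### Alternating binomial sums (Hausdorff differences) -/

/-- Pascal's rule for Hausdorff differences:
`Σ_{i ≤ k+1} (-1)^i C(k+1,i) μ_{j+i} = Σ_{i ≤ k} (-1)^i C(k,i) (μ_{j+i} - μ_{j+i+1})`. -/
theorem altSum_succ (μ : ℕ → ℝ) (k j : ℕ) :
    ∑ i ∈ range (k + 2), (-1 : ℝ) ^ i * ((k + 1).choose i : ℝ) * μ (j + i) =
      ∑ i ∈ range (k + 1), (-1 : ℝ) ^ i * (k.choose i : ℝ) * (μ (j + i) - μ (j + i + 1)) := by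
  have h1 : ∑ i ∈ range (k + 1), (-1 : ℝ) ^ i * (k.choose i : ℝ) * (μ (j + i) - μ (j + i + 1)) =
      ∑ i ∈ range (k + 1), (-1 : ℝ) ^ i * (k.choose i : ℝ) * μ (j + i) +
        ∑ i ∈ range (k + 1), (-1 : ℝ) ^ (i + 1) * (k.choose i : ℝ) * μ (j + (i + 1)) := by
    rw [← sum_add_distrib]
    refine sum_congr rfl fun i _ => ?_
    rw [pow_succ]
    ring_nf
  rw [h1, sum_range_succ' (fun i => (-1 : ℝ) ^ i * ((k + 1).choose i : ℝ) * μ (j + i))]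
  simp only [Nat.choose_succ_succ, Nat.cast_add, pow_zero, Nat.choose_zero_right, Nat.cast_one,
    one_mul, add_zero]
  have h2 : ∑ i ∈ range (k + 1), (-1 : ℝ) ^ (i + 1) * ((k.choose i : ℝ) + (k.choose (i + 1) : ℝ)) *
      μ (j + (i + 1)) =
      ∑ i ∈ range (k + 1), (-1 : ℝ) ^ (i + 1) * (k.choose i : ℝ) * μ (j + (i + 1)) +
        ∑ i ∈ range (k + 1), (-1 : ℝ) ^ (i + 1) * (k.choose (i + 1) : ℝ) * μ (j + (i + 1)) := by
    rw [← sum_add_distrib]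
    refine sum_congr rfl fun i _ => ?_
    ring
  rw [h2]
  have h3 : ∑ i ∈ range (k + 1), (-1 : ℝ) ^ (i + 1) * (k.choose (i + 1) : ℝ) * μ (j + (i + 1)) + μ j =
      ∑ i ∈ range (k + 1), (-1 : ℝ) ^ i * (k.choose i : ℝ) * μ (j + i) := by
    rw [sum_range_succ (fun i => (-1 : ℝ) ^ (i + 1) * (k.choose (i + 1) : ℝ) * μ (j + (i + 1))),
      Nat.choose_eq_zero_of_lt (Nat.lt_succ_self k), Nat.cast_zero, mul_zero, zero_mul, add_zero,
      sum_range_succ' (fun i => (-1 : ℝ) ^ i * (k.choose i : ℝ) * μ (j + i))]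
    simp
  linarith [h3]

/-- Order `0`: a strictly completely monotone sequence is positive. -/
theorem pos_of_altSum (μ : ℕ → ℝ)
    (hμ : ∀ k j, 0 < ∑ i ∈ range (k + 1), (-1 : ℝ) ^ i * (k.choose i : ℝ) * μ (j + i)) (n : ℕ) :
    0 < μ n := by
  simpa using hμ 0 n

/-- Order `1`: a strictly completely monotone sequence is strictly decreasing. -/
theorem lt_of_altSum (μ : ℕ → ℝ)
    (hμ : ∀ k j, 0 < ∑ i ∈ range (k + 1), (-1 : ℝ) ^ i * (k.choose i : ℝ) * μ (j + i)) (n : ℕ) :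
    μ (n + 1) < μ n := by
  have := hμ 1 n
  simp [sum_range_succ] at this
  linarith

/-- The difference sequence `μ'_r = μ_r - μ_{r+1}` of a strictly completely monotone sequence is again
strictly completely monotone. -/
theorem altSum_diff_pos (μ : ℕ → ℝ)
    (hμ : ∀ k j, 0 < ∑ i ∈ range (k + 1), (-1 : ℝ) ^ i * (k.choose i : ℝ) * μ (j + i)) (k j : ℕ) :
    0 < ∑ i ∈ range (k + 1), (-1 : ℝ) ^ i * (k.choose i : ℝ) * (μ (j + i) - μ (j + i + 1)) := by
  rw [← altSum_succ]
  exact hμ (k + 1) j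

/-- The reparametrisation of the Neville step: with `σ_n = 1 - μ_n/μ_{n-1}`,
`σ'_k := 1 - μ'_k/μ'_{k-1}` (`μ' = μ - μ(·+1)`) equals `1 + σ_{k+1} - σ_{k+1}/σ_k`. -/
theorem sigma_diff_eq (x y z : ℝ) (hx : x ≠ 0) (hy : y ≠ 0) (hxy : x - y ≠ 0) :
    1 - (y - z) / (x - y) = 1 + (1 - z / y) - (1 - z / y) / (1 - y / x) := by
  have h : 1 - y / x = (x - y) / x := by field_simp
  rw [h]
  field_simp
  ring


/-! ### The Neville step in closed form -/

/-- Row `0` of `Q_σ` equals row `0` of the block kernel `1 ⊕ Q_σ'`. -/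
theorem neville_zero (σ σ' : ℕ → ℝ) (l : ℕ) :
    (if 0 = 0 then (if l = 0 then (1:ℝ) else 0) else (if l = 0 then (0:ℝ) else ((0 - 1).choose (l - 1) : ℝ)) + σ (0) * ((0 - 1).choose (l) : ℝ)) =
      (if 0 = 0 ∧ l = 0 then (1:ℝ) else if 0 = 0 ∨ l = 0 then 0 else (if (0 - 1) = 0 then (if (l - 1) = 0 then (1:ℝ) else 0) else (if (l - 1) = 0 then (0:ℝ) else (((0 - 1) - 1).choose ((l - 1) - 1) : ℝ)) + σ' ((0 - 1)) * (((0 - 1) - 1).choose ((l - 1)) : ℝ))) := by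
  by_cases hl : l = 0 <;> simp [hl]

/-- **The Neville step** (memo (2.1)–(2.2)): subtracting `(s_(n+1)/s_n)` times row `n` of `Q_σ` from row
`n+1` leaves row `n+1` of `1 ⊕ Q_σ'`, where `σ'_k = 1 + σ_(k+1) - σ_(k+1)/σ_k` and `s_0 = 1`,
`s_n = σ_n`; i.e. `(1+x)(x+σ_(n+1)) - (σ_(n+1)/σ_n)(x+σ_n) = x (x + σ'_n)`. -/
theorem neville_step (σ σ' : ℕ → ℝ) (hσ : ∀ k, 1 ≤ k → σ k ≠ 0)
    (hσ' : ∀ k, 1 ≤ k → σ' k = 1 + σ (k + 1) - σ (k + 1) / σ k) (n l : ℕ) :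
    (if n + 1 = 0 then (if l = 0 then (1:ℝ) else 0) else (if l = 0 then (0:ℝ) else ((n + 1 - 1).choose (l - 1) : ℝ)) + σ (n + 1) * ((n + 1 - 1).choose (l) : ℝ)) =
      (if n + 1 = 0 ∧ l = 0 then (1:ℝ) else if n + 1 = 0 ∨ l = 0 then 0 else (if (n + 1 - 1) = 0 then (if (l - 1) = 0 then (1:ℝ) else 0) else (if (l - 1) = 0 then (0:ℝ) else (((n + 1 - 1) - 1).choose ((l - 1) - 1) : ℝ)) + σ' ((n + 1 - 1)) * (((n + 1 - 1) - 1).choose ((l - 1)) : ℝ))) +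
        ((if n + 1 = 0 then (1:ℝ) else σ (n + 1)) / (if n = 0 then (1:ℝ) else σ n)) *
          (if n = 0 then (if l = 0 then (1:ℝ) else 0) else (if l = 0 then (0:ℝ) else ((n - 1).choose (l - 1) : ℝ)) + σ (n) * ((n - 1).choose (l) : ℝ)) := by
  rcases n with _ | n
  · -- row 1 from row 0
    rcases l with _ | _ | l <;> simp
  · have hs : σ (n + 1) ≠ 0 := hσ (n + 1) (by omega)
    simp only [Nat.add_sub_cancel, Nat.add_one_ne_zero, if_false, false_and, false_or]
    rw [hσ' (n + 1) (by omega)]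
    rcases l with _ | _ | l
    · simp
      field_simp
    · simp
      field_simp
      ring
    · simp [Nat.choose_succ_succ]
      field_simp
      ring

/-- **Undoing the Neville step**: if `Q 0 = M 0` and `Q (n+1) = M (n+1) + (s_(n+1)/s_n) Q n` (rows), then
`Q = L̂ M` with `L̂(n,j) = [j ≤ n] s_n/s_j`. -/
theorem sum_form (Q M : ℕ → ℕ → ℝ) (s : ℕ → ℝ) (hs : ∀ n, s n ≠ 0) (h0 : ∀ l, Q 0 l = M 0 l)
    (hstep : ∀ n l, Q (n + 1) l = M (n + 1) l + s (n + 1) / s n * Q n l) (n l : ℕ) :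
    Q n l = ∑ j ∈ range (n + 1), (if j ≤ n then s n / s j else 0) * M j l := by
  induction n with
  | zero => simp [h0, div_self (hs 0)]
  | succ n ih =>
    rw [hstep, ih, Finset.sum_range_succ (fun j => (if j ≤ n + 1 then s (n + 1) / s j else 0) * M j l),
      if_pos (le_refl _), div_self (hs (n + 1)), one_mul, add_comm, Finset.mul_sum]
    congr 1
    refine sum_congr rfl fun j hj => ?_
    rw [mem_range] at hj
    rw [if_pos (by omega), if_pos (by omega), ← mul_assoc]
    congr 1
    have hn' := hs n
    have hj' := hs j
    field_simp

/-! ### The main theorem -/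

/-- **THEOREM W♯ (⟸), truncated form.**  If `μ` is strictly completely monotone then every minor of
`Q_μ` (`σ_n = 1 - μ_n/μ_(n-1)`) with indices `< N` is nonnegative.  Induction on `N` over all such `μ`
simultaneously: `Q_μ = L̂ (1 ⊕ Q_μ')` with `μ' = μ - μ(·+1)`. -/
theorem momentRatio_minor_nonneg (N : ℕ) : ∀ (μ : ℕ → ℝ),
    (∀ k j, 0 < ∑ i ∈ range (k + 1), (-1 : ℝ) ^ i * (k.choose i : ℝ) * μ (j + i)) →
    ∀ (k : ℕ) (r c : Fin k → ℕ), StrictMono r → StrictMono c → (∀ i, r i < N) → (∀ j, c j < N) →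
    0 ≤ (Matrix.of fun i j =>
      (if r i = 0 then (if c j = 0 then (1:ℝ) else 0) else (if c j = 0 then (0:ℝ) else ((r i - 1).choose (c j - 1) : ℝ)) + (1 - μ (r i) / μ (r i - 1)) * ((r i - 1).choose (c j) : ℝ))).det := by
  induction N with
  | zero =>
    intro μ hμ k r c hr hc hrN hcN
    cases k with
    | zero => simp
    | succ k => exact absurd (hrN 0) (Nat.not_lt_zero _)
  | succ N ih =>
    intro μ hμ k r c hr hc hrN hcN
    -- positivity facts
    have hpos : ∀ n, 0 < μ n := pos_of_altSum μ hμ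
    have hlt : ∀ n, μ (n + 1) < μ n := lt_of_altSum μ hμ
    have hσpos : ∀ n, 1 ≤ n → 0 < 1 - μ n / μ (n - 1) := by
      intro n hn
      obtain ⟨m, rfl⟩ := Nat.exists_eq_add_of_le' hn
      rw [Nat.add_sub_cancel, sub_pos, div_lt_one (hpos m)]
      exact hlt m
    -- the difference sequence and its kernel
    have hμ' : ∀ k j, 0 < ∑ i ∈ range (k + 1), (-1 : ℝ) ^ i * (k.choose i : ℝ) *
        (μ (j + i) - μ (j + i + 1)) := altSum_diff_pos μ hμ
    have ih' := ih (fun r => μ r - μ (r + 1)) hμ'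
    -- the pivots s_n (s_0 = 1, s_n = σ_n) and the Neville relation
    have hs : ∀ n, (fun n => if n = 0 then (1 : ℝ) else 1 - μ n / μ (n - 1)) n ≠ 0 := by
      intro n
      by_cases hn : n = 0
      · simp [hn]
      · simp only [hn, if_false]
        exact (hσpos n (by omega)).ne'
    have hrel : ∀ k, 1 ≤ k → (1 - (μ k - μ (k + 1)) / (μ (k - 1) - μ (k - 1 + 1))) =
        1 + (1 - μ (k + 1) / μ (k + 1 - 1)) - (1 - μ (k + 1) / μ (k + 1 - 1)) / (1 - μ k / μ (k - 1)) := by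
      intro k hk
      obtain ⟨m, rfl⟩ := Nat.exists_eq_add_of_le' hk
      simp only [Nat.add_sub_cancel]
      exact sigma_diff_eq (μ m) (μ (m + 1)) (μ (m + 1 + 1)) (hpos m).ne' (hpos (m + 1)).ne'
        (sub_ne_zero.2 (hlt m).ne')
    have key := sum_form
      (fun n l => (if n = 0 then (if l = 0 then (1:ℝ) else 0) else (if l = 0 then (0:ℝ) else ((n - 1).choose (l - 1) : ℝ)) + (1 - μ (n) / μ (n - 1)) * ((n - 1).choose (l) : ℝ)))
      (fun n l => (if n = 0 ∧ l = 0 then (1:ℝ) else if n = 0 ∨ l = 0 then 0 else (if (n - 1) = 0 then (if (l - 1) = 0 then (1:ℝ) else 0) else (if (l - 1) = 0 then (0:ℝ) else (((n - 1) - 1).choose ((l - 1) - 1) : ℝ)) + (1 - (μ ((n - 1)) - μ ((n - 1) + 1)) / (μ ((n - 1) - 1) - μ ((n - 1) - 1 + 1))) * (((n - 1) - 1).choose ((l - 1)) : ℝ))))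
      (fun n => if n = 0 then (1 : ℝ) else 1 - μ n / μ (n - 1)) hs
      (fun l => neville_zero (fun n => 1 - μ n / μ (n - 1))
        (fun n => 1 - (μ n - μ (n + 1)) / (μ (n - 1) - μ (n - 1 + 1))) l)
      (fun n l => neville_step (fun n => 1 - μ n / μ (n - 1))
        (fun n => 1 - (μ n - μ (n + 1)) / (μ (n - 1) - μ (n - 1 + 1)))
        (fun k hk => (hσpos k hk).ne') hrel n l)
    have hmat : (Matrix.of fun i j =>
        (if r i = 0 then (if c j = 0 then (1:ℝ) else 0) else (if c j = 0 then (0:ℝ) else ((r i - 1).choose (c j - 1) : ℝ)) + (1 - μ (r i) / μ (r i - 1)) * ((r i - 1).choose (c j) : ℝ))) =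
        Matrix.of fun i j => ∑ t ∈ range (r i + 1),
          (fun n l => if l ≤ n then (fun n => if n = 0 then (1 : ℝ) else 1 - μ n / μ (n - 1)) n /
            (fun n => if n = 0 then (1 : ℝ) else 1 - μ n / μ (n - 1)) l else 0) (r i) t *
          (fun n l => (if n = 0 ∧ l = 0 then (1:ℝ) else if n = 0 ∨ l = 0 then 0 else (if (n - 1) = 0 then (if (l - 1) = 0 then (1:ℝ) else 0) else (if (l - 1) = 0 then (0:ℝ) else (((n - 1) - 1).choose ((l - 1) - 1) : ℝ)) + (1 - (μ ((n - 1)) - μ ((n - 1) + 1)) / (μ ((n - 1) - 1) - μ ((n - 1) - 1 + 1))) * (((n - 1) - 1).choose ((l - 1)) : ℝ)))) t (c j) := by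
      ext i j
      exact key (r i) (c j)
    rw [hmat]
    refine TNKernel.mulLower_minor_nonneg
      (fun n l => if l ≤ n then (fun n => if n = 0 then (1 : ℝ) else 1 - μ n / μ (n - 1)) n /
            (fun n => if n = 0 then (1 : ℝ) else 1 - μ n / μ (n - 1)) l else 0)
      (fun n l => (if n = 0 ∧ l = 0 then (1:ℝ) else if n = 0 ∨ l = 0 then 0 else (if (n - 1) = 0 then (if (l - 1) = 0 then (1:ℝ) else 0) else (if (l - 1) = 0 then (0:ℝ) else (((n - 1) - 1).choose ((l - 1) - 1) : ℝ)) + (1 - (μ ((n - 1)) - μ ((n - 1) + 1)) / (μ ((n - 1) - 1) - μ ((n - 1) - 1 + 1))) * (((n - 1) - 1).choose ((l - 1)) : ℝ)))) (N + 1) ?_ ?_ ?_ r c hr hc hrN hcN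
    · -- L̂ is TN
      intro k r c hr hc
      have hsp : ∀ n, 0 < (fun n => if n = 0 then (1 : ℝ) else 1 - μ n / μ (n - 1)) n := by
        intro n
        by_cases hn : n = 0
        · simp [hn]
        · simp only [hn, if_false]
          exact hσpos n (by omega)
      exact TNKernel.ratioStair_minor_nonneg _ hsp r c hr hc
    · -- 1 ⊕ Q_μ' is TN up to N + 1
      intro k r c hr hc hrN hcN
      exact TNKernel.blockOne_minor_nonneg
        (fun n l => (if n = 0 then (if l = 0 then (1:ℝ) else 0) else (if l = 0 then (0:ℝ) else ((n - 1).choose (l - 1) : ℝ)) + (1 - (μ (n) - μ (n + 1)) / (μ (n - 1) - μ (n - 1 + 1))) * ((n - 1).choose (l) : ℝ))) N ih' r c hr hc hrN hcN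
    · intro n j hnj
      simp [not_le.2 hnj]

/-- **THEOREM W♯ (⟸).**  If `μ` is strictly completely monotone then `Q_μ` is totally nonnegative. -/
theorem momentRatio_tn (μ : ℕ → ℝ)
    (hμ : ∀ k j, 0 < ∑ i ∈ range (k + 1), (-1 : ℝ) ^ i * (k.choose i : ℝ) * μ (j + i))
    {k : ℕ} (r c : Fin k → ℕ) (hr : StrictMono r) (hc : StrictMono c) :
    0 ≤ (Matrix.of fun i j =>
      (if r i = 0 then (if c j = 0 then (1:ℝ) else 0) else (if c j = 0 then (0:ℝ) else ((r i - 1).choose (c j - 1) : ℝ)) + (1 - μ (r i) / μ (r i - 1)) * ((r i - 1).choose (c j) : ℝ))).det := by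
  refine momentRatio_minor_nonneg ((univ.sup r) + (univ.sup c) + 1) μ hμ k r c hr hc
    (fun i => ?_) (fun j => ?_)
  · have : r i ≤ univ.sup r := Finset.le_sup (f := r) (mem_univ i)
    omega
  · have : c j ≤ univ.sup c := Finset.le_sup (f := c) (mem_univ j)
    omega

/-! ### The kernel `(l + c_n)/(n-l)!` -/

/-- Two factorial identities behind `(l + c_n) n! = (n + c_n) Q(n,l) l! (n-l)!`. -/
theorem choose_factorial_identities (n l : ℕ) (hl : l ≤ n) :
    ((n.choose l : ℕ) : ℝ) * ((l + 1)! : ℕ) * ((n - l)! : ℕ) = (n ! : ℕ) * ((l : ℝ) + 1) ∧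
      ((n.choose (l + 1) : ℕ) : ℝ) * ((l + 1)! : ℕ) * ((n - l)! : ℕ) = (n ! : ℕ) * ((n : ℝ) - l) := by
  constructor
  · have h := Nat.choose_mul_factorial_mul_factorial hl
    have h' : ((n.choose l : ℕ) : ℝ) * (l ! : ℕ) * ((n - l)! : ℕ) = (n ! : ℕ) := by exact_mod_cast h
    rw [Nat.factorial_succ]
    push_cast
    linear_combination ((l : ℝ) + 1) * h'
  · rcases Nat.lt_or_ge l n with hlt | hge
    · have hle : l + 1 ≤ n := hlt
      have h := Nat.choose_mul_factorial_mul_factorial hle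
      have h' : ((n.choose (l + 1) : ℕ) : ℝ) * ((l + 1)! : ℕ) * ((n - (l + 1))! : ℕ) = (n ! : ℕ) := by
        exact_mod_cast h
      have hsub : n - l = (n - (l + 1)) + 1 := by omega
      rw [hsub, Nat.factorial_succ (n - (l + 1))]
      push_cast [Nat.cast_sub hle]
      linear_combination ((n : ℝ) - l) * h'
    · have hln : l = n := le_antisymm hl hge
      subst hln
      rw [Nat.choose_succ_self, Nat.sub_self]
      simp

/-- The entrywise identity `(l + c_n)/(n-l)! = u_n · Q_μ(n,l) · l!` with `u_0 = c_0`,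
`u_n = (n + c_n)/n!`, when `σ_n = 1 - μ_n/μ_(n-1) = c_n/(n + c_n)`. -/
theorem lPlusC_entry_eq (c μ : ℕ → ℝ) (hc : ∀ n, 0 < c n)
    (hσ : ∀ n, 1 ≤ n → 1 - μ n / μ (n - 1) = c n / (n + c n)) (n l : ℕ) :
    (if l ≤ n then ((l : ℝ) + c n) / ((n - l)! : ℕ) else 0) =
      (if n = 0 then c 0 else ((n : ℝ) + c n) / (n ! : ℕ)) *
        (if n = 0 then (if l = 0 then (1:ℝ) else 0) else (if l = 0 then (0:ℝ) else ((n - 1).choose (l - 1) : ℝ)) + (1 - μ (n) / μ (n - 1)) * ((n - 1).choose (l) : ℝ)) * (l ! : ℕ) := by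
  rcases n with _ | n
  · by_cases hl : l = 0
    · subst hl; simp
    · have : ¬ l ≤ 0 := by omega
      simp [hl, this]
  · have hpos : (0 : ℝ) < (n : ℝ) + 1 + c (n + 1) := by have := hc (n + 1); positivity
    rw [hσ (n + 1) (by omega)]
    simp only [Nat.add_one_ne_zero, if_false, Nat.add_sub_cancel, Nat.cast_add, Nat.cast_one]
    rcases l with _ | l
    · simp
      field_simp
    · simp only [Nat.add_one_ne_zero, if_false, Nat.add_sub_cancel]
      by_cases hl : l + 1 ≤ n + 1
      · rw [if_pos hl]
        have hln : l ≤ n := by omega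
        obtain ⟨h1, h2⟩ := choose_factorial_identities n l hln
        have hf : ((n + 1 - (l + 1))! : ℕ) = (n - l)! := by rw [Nat.add_sub_add_right]
        rw [hf]
        have hfac : ((n - l)! : ℝ) ≠ 0 := by positivity
        have hfac2 : (((n + 1)! : ℕ) : ℝ) ≠ 0 := by positivity
        have hfac3 : (((l + 1)! : ℕ) : ℝ) ≠ 0 := by positivity
        have eC1 : ((n.choose l : ℕ) : ℝ) = (n ! : ℕ) * ((l : ℝ) + 1) / (((l + 1)! : ℕ) * ((n - l)! : ℕ)) := by
          rw [eq_div_iff (mul_ne_zero hfac3 hfac)]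
          linear_combination h1
        have eC2 : ((n.choose (l + 1) : ℕ) : ℝ) = (n ! : ℕ) * ((n : ℝ) - l) / (((l + 1)! : ℕ) * ((n - l)! : ℕ)) := by
          rw [eq_div_iff (mul_ne_zero hfac3 hfac)]
          linear_combination h2
        rw [eC1, eC2, Nat.factorial_succ n]
        have hpos' := hpos.ne'
        have hfac4 : ((n ! : ℕ) : ℝ) ≠ 0 := by positivity
        push_cast
        field_simp
        ring
      · rw [if_neg hl]
        have h3 : n.choose l = 0 := Nat.choose_eq_zero_of_lt (by omega)
        have h4 : n.choose (l + 1) = 0 := Nat.choose_eq_zero_of_lt (by omega)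
        simp [h3, h4]

/-- **THEOREM W♯ (⟸) for the kernel `(l + c_n)/(n-l)!`** (g34's CONJECTURE W in exact form): if
`c_n > 0` and `μ_r := r!/∏_(m=1..r) (m + c_m)` is strictly completely monotone, then
`[(l + c_n)/(n-l)!]_(l ≤ n)` is totally nonnegative. -/
theorem lPlusC_div_factorial_tn (c : ℕ → ℝ) (hc : ∀ n, 0 < c n)
    (hμ : ∀ k j, 0 < ∑ i ∈ range (k + 1), (-1 : ℝ) ^ i * (k.choose i : ℝ) *
      (((j + i)! : ℕ) / ∏ m ∈ range (j + i), ((m : ℝ) + 1 + c (m + 1))))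
    {k : ℕ} (r c' : Fin k → ℕ) (hr : StrictMono r) (hc' : StrictMono c') :
    0 ≤ (Matrix.of fun i j =>
      if c' j ≤ r i then ((c' j : ℝ) + c (r i)) / ((r i - c' j)! : ℕ) else 0).det := by
  set μ : ℕ → ℝ := fun r => (r ! : ℕ) / ∏ m ∈ range r, ((m : ℝ) + 1 + c (m + 1)) with hμdef
  have hprod : ∀ r, 0 < ∏ m ∈ range r, ((m : ℝ) + 1 + c (m + 1)) := fun r =>
    prod_pos fun m _ => by have := hc (m + 1); positivity
  have hμpos : ∀ r, 0 < μ r := fun r => by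
    simp only [hμdef]
    exact div_pos (by positivity) (hprod r)
  have hσ : ∀ n, 1 ≤ n → 1 - μ n / μ (n - 1) = c n / (n + c n) := by
    intro n hn
    obtain ⟨m, rfl⟩ := Nat.exists_eq_add_of_le' hn
    have h2 : (0 : ℝ) < (m : ℝ) + 1 + c (m + 1) := by have := hc (m + 1); positivity
    have hratio : μ (m + 1) = μ m * (((m : ℝ) + 1) / ((m : ℝ) + 1 + c (m + 1))) := by
      simp only [hμdef]
      rw [prod_range_succ, Nat.factorial_succ, Nat.cast_mul, Nat.cast_succ, div_mul_div_comm]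
      ring
    rw [Nat.add_sub_cancel, hratio, Nat.cast_succ]
    have hμm := (hμpos m).ne'
    have h2' := h2.ne'
    field_simp
    ring
  have hmat : (Matrix.of fun i j =>
      if c' j ≤ r i then ((c' j : ℝ) + c (r i)) / ((r i - c' j)! : ℕ) else 0) =
      Matrix.of fun i j => (fun n : ℕ => if n = 0 then c 0 else ((n : ℝ) + c n) / (n ! : ℕ)) (r i) *
        (fun n l : ℕ => (if n = 0 then (if l = 0 then (1:ℝ) else 0) else (if l = 0 then (0:ℝ) else ((n - 1).choose (l - 1) : ℝ)) + (1 - μ (n) / μ (n - 1)) * ((n - 1).choose (l) : ℝ))) (r i) (c' j) * (fun l : ℕ => ((l ! : ℕ) : ℝ)) (c' j) := by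
    ext i j
    exact lPlusC_entry_eq c μ hc hσ (r i) (c' j)
  rw [hmat, TNKernel.det_kernel_scale (fun n l : ℕ => (if n = 0 then (if l = 0 then (1:ℝ) else 0) else (if l = 0 then (0:ℝ) else ((n - 1).choose (l - 1) : ℝ)) + (1 - μ (n) / μ (n - 1)) * ((n - 1).choose (l) : ℝ)))
    (fun n : ℕ => if n = 0 then c 0 else ((n : ℝ) + c n) / (n ! : ℕ)) (fun l : ℕ => ((l ! : ℕ) : ℝ)) r c']
  refine mul_nonneg (prod_nonneg fun i _ => ?_) (mul_nonneg (prod_nonneg fun j _ => by positivity) ?_)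
  · by_cases h0 : r i = 0
    · simp [h0, (hc 0).le]
    · simp only [h0, if_false]
      have := hc (r i); positivity
  · exact momentRatio_tn μ (fun k j => by simpa [hμdef] using hμ k j) r c' hr hc'

end MomentRatioTN

end Summit.CriticalPhenomena.PercolationContinuityZ3.Theorems
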